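import Summits.QuantumFields.BalabanUV.Beta.GAN24.ContactKernelCells
import Summits.QuantumFields.BalabanUV.Beta.GAN24.ContactPartnerLetters
import Summits.QuantumFields.BalabanUV.Beta.GAN24.ContactGaugeStaircase
import Summits.QuantumFields.BalabanUV.Beta.GAN24.StaircasePairing

/-!
# `BalabanUV.Beta.GAN24.ContactCellLetters` — binder row G-an2-4 / (CONV-C), the row owner's CONTACT-TERM ROUTE (`gen19/CT3-MECHANISM-v1.2.md` §A–§B), CT-3c
# analysis at `d = 3`, `m = 0`, part 1 of `ContactCellBounds`: THE LETTERS IN THE SHAPES THE CELLS EAT — the plain envelope of the bond gauge function from its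
# staircase, the dressed leg opened in the B6 spelling, and the Maxwell operators of both partners as the translated tent force.

NOT IN PRINT; OUR BOOKKEEPING (G-an2-4 formalisation swarm, leaf prover `b2b-balaban-gan24-formalise-leaf-01`, gen 58; CT-3c under «MINE»; owner's GO
`CT3-MECHANISM-v1.2.md` §A∕§B (l.31770), choice (b) (l.31846 ∕ l.31868): the TIP-position dressed partners through leaf-03 g52's
`StaircasePairingReadings.abs_pairingTip_le_of_geometric`, the MIDPOINT one through the owner's `StaircasePairing.abs_pairing_le_sum`).  HONEST FRAMING (cell
contract, verbatim): «discharging `BetaPertH` makes Bałaban's UV stability UNCONDITIONAL — a real constructive-QFT result; it is NOT the continuum limit and NOT the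
Clay problem.»  HONEST DEPENDENCY (verbatim): «continuum YM on T⁴ ⇐ BetaPertH ∧ nine spine estimates (0/9 proved); BetaPertH ⇐ (D1) ∧ (D4) ∧ CAP+tail; G-an2-4
gates asym, D1 and NE2/3/4.»

WHAT (`d = 3`, in-block root `ρ = toSite rr`, `N = Lc^(k+1)`, `T = legChain (respStepBmSeq ρ Lc) 0 k`, `B = respStep (Lc^0) (Lc^(0+k+1))`, bond gauge functions
`λ μ z = Psi ρ Lc 0 k (delta1 μ z) − bmGaugeAt ρ (B μ z) Lc`, tent forces `t_{μ,z} = 𝒬ᵀ_N φ_{μ,z}`, `φ_{μ,z} κ y = wΦ κ μ (y − z)`; letters: (N1) `C`, I1 `Φ₀` at the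
common rate `κ₀`; derived `α = 8·Lc·C·(Lc^{5(k+1)})⁻¹`, `Eψ = 2α·Lc^k`, `C_B = C·(Lc^{5(k+1)})⁻¹`, `Φ₀′ = Φ₀·(Lc^{8(k+1)})⁻¹`, `τ = N·Φ₀′·e^{κ₀}`,
`ENV(p; q, r) = N^4·Zl 4 (κ₀∕16)·e^{−(κ₀∕12)(‖q−p‖∞+‖r−p‖∞)}`):
* §1 the letters in the shapes the cells eat: `abs_gauge_le` (plain envelope of `λ`: `2αLc^k·E_z`), `legChain_apply_eq` (`T μ z κ u = B μ z κ u + (λ(u+e_κ) − λ u)`,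
  B6 spelling), `curvAdj_curv_legChain_zero_eq_contourSumAdj` (`d*d(T μ z) = t_{μ,z}`), `curvAdj_curv_respStep_zero_eq_contourSumAdj`.
[folklore] throughout: bookkeeping over leaf-02's cells, the owner's and leaf-03's staircase pairings, my `ContactCellReduction` ∕ `ContactGaugeStaircase` ∕
`ContactPartnerLetters` ∕ `ContactKernelCells` BY NAME; 0 `def`, 0 cited facts, 0 `def … : Prop`, 0 sorry.  NO new estimate; discharges NOTHING of (hS, hSall) on (E);
0 wall binders; NEVER «G-an2-4 closed»; NOT D1, NOT BetaPertH, NOT continuum, NOT Clay.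
-/

noncomputable section

open Finset
open scoped BigOperators
open Literature.MathematicalPhysics.QuantumFieldTheory
open Literature.MathematicalPhysics.QuantumFieldTheory.LatticeForm (quo)
open Literature.MathematicalPhysics.QuantumFieldTheory.Balaban1983to89
open Literature.MathematicalPhysics.QuantumFieldTheory.Balaban1983to89.Beta
open B4ContourShift (supNorm supNorm_nonneg)
open ExpKernelCalculus (Zl Zl_nonneg)
open AffineAveraging (Form0 Form1 Site box toSite curv curvAdj dz)
open AffineReproduction (contourSumAdj)
open AveragingContours (blk)
open KernelSpecInstance (wΦ)
open B6BondElimination (unitVec)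
open KKTFluctuationKernel (delta1)
open BalabanCompositeJets (respStep)
open Summit.QuantumFields.BalabanUV.Beta.AxialProjectorBlockMean (bmGaugeAt)
open Summit.QuantumFields.BalabanUV.Beta.GAN24.Push4Iter (LegFam legChain)
open Summit.QuantumFields.BalabanUV.Beta.GAN24.RespStepBmDecompLegs (legAct)
open Summit.QuantumFields.BalabanUV.Beta.GAN24.RespStepBmDecompExact (respStepBmSeq)
open Summit.QuantumFields.BalabanUV.Beta.GAN24.RespStepBmDecompPsi (Psi)
open Summit.QuantumFields.BalabanUV.Beta.GAN24.EnvelopeBlockSum (env_le_one summable_env)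
open Summit.QuantumFields.BalabanUV.Beta.GAN24.ContactOneGaugeCellAlgebra (affine_unitVec_eq dz_apply')
open Summit.QuantumFields.BalabanUV.Beta.GAN24.ContactKernelCells (legChain_respStepBmSeq_apply_eq_add_dz)
open Summit.QuantumFields.BalabanUV.Beta.GAN24.ContactPartnerLetters (curvAdj_curv_legChain_eq curvAdj_curv_respStep_one_eq_contourSumAdj respStep_pow_zero)
open Summit.QuantumFields.BalabanUV.Beta.GAN24.ContactGaugeStaircase (gauge_eq_staircase abs_gaugePiece_le)
open Summit.QuantumFields.BalabanUV.Beta.GAN24.StaircasePairing (abs_pairing_le_sum sum_weights_le_of_geometric sum_pow_le)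

namespace Summit.QuantumFields.BalabanUV.Beta.GAN24.ContactCellLetters

variable {Lc : ℕ} [NeZero Lc]

/-! ## §1 The letters in the shapes the cells eat (`d = 3`, `m = 0`) -/

section Letters

variable {κ₀ C : ℝ} {rr : Fin (3 + 1) → ℕ}

/-- NOT IN PRINT; OUR BOOKKEEPING.  **THE PLAIN ENVELOPE OF THE BOND GAUGE FUNCTION** from its staircase pieces (`2 ≤ Lc`; (N1) letters `κ₀, C`):
`|λ μ z u| ≤ (2·(8·Lc·C·(Lc^{5(k+1)})⁻¹)·Lc^k)·e^{−κ₀‖quo (Lc^(k+1)) u − z‖∞}` (`Σ_{s≤k} Lc^s ≤ 2Lc^k`, the owner's `sum_pow_le`). -/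
theorem abs_gauge_le (hLc : 2 ≤ Lc) (hC : 0 ≤ C)
    (hN1 : ∀ (m k : ℕ) (μ : Fin (3 + 1)) (z : Site (3 + 1)) (l'' : Fin (3 + 1)) (w' : Site (3 + 1)),
      |respStep (d := 3) (Lc ^ m) (Lc ^ (m + k + 1)) μ z l'' w'| ≤
        C * ((Lc : ℝ) ^ (5 * (k + 1)))⁻¹ * Real.exp (-(κ₀ * supNorm (quo (Lc ^ (k + 1)) w' - z))))
    (hrr : rr ∈ box (3 + 1) Lc) (k : ℕ) (μ : Fin (3 + 1)) (z u : Site (3 + 1)) :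
    |Psi (toSite rr) Lc 0 k (delta1 μ z) u - bmGaugeAt (toSite rr) (respStep (d := 3) (Lc ^ 0) (Lc ^ (0 + k + 1)) μ z) Lc u|
      ≤ (2 * (8 * (Lc : ℝ) * C * ((Lc : ℝ) ^ (5 * (k + 1)))⁻¹) * (Lc : ℝ) ^ k) * Real.exp (-(κ₀ * supNorm (quo (Lc ^ (k + 1)) u - z))) := by
  have hL : (2 : ℝ) ≤ (Lc : ℝ) := by exact_mod_cast hLc
  have hL0 : (0 : ℝ) ≤ (Lc : ℝ) := by linarith
  set E := Real.exp (-(κ₀ * supNorm (quo (Lc ^ (k + 1)) u - z))) with hE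
  set α : ℝ := 8 * (Lc : ℝ) * C * ((Lc : ℝ) ^ (5 * (k + 1)))⁻¹ with hα
  have hα0 : 0 ≤ α := by positivity
  rw [gauge_eq_staircase (toSite rr) 0 k μ z u]
  calc |∑ s ∈ Finset.range (k + 1), _|
      ≤ ∑ s ∈ Finset.range (k + 1), α * (Lc : ℝ) ^ s * E := by
        refine (Finset.abs_sum_le_sum_abs _ _).trans (Finset.sum_le_sum fun s hs => ?_)
        have h := abs_gaugePiece_le (Lc := Lc) hN1 hrr 0 k μ z (Nat.lt_succ_iff.1 (Finset.mem_range.1 hs)) u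
        rw [← hE] at h
        refine h.trans (le_of_eq ?_)
        rw [hα]
    _ = α * E * ∑ s ∈ Finset.range (k + 1), (Lc : ℝ) ^ s := by rw [Finset.mul_sum]; exact Finset.sum_congr rfl fun s _ => by ring
    _ ≤ α * E * (2 * (Lc : ℝ) ^ k) := mul_le_mul_of_nonneg_left (sum_pow_le hL k) (by positivity)
    _ = (2 * α * (Lc : ℝ) ^ k) * E := by ring

/-- [folklore] **THE DRESSED LEG OPENED, B6 spelling**: `T μ z κ u = B μ z κ u + (λ(u + e_κ) − λ u)` (`ContactKernelCells.legChain_respStepBmSeq_apply_eq_add_dz`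
+ leaf-02's `dz_apply'`). -/
theorem legChain_apply_eq (hrr : rr ∈ box (3 + 1) Lc) (k : ℕ) (μ : Fin (3 + 1)) (z : Site (3 + 1)) (κ : Fin (3 + 1)) (u : Site (3 + 1)) :
    legChain (respStepBmSeq (d := 3) (toSite rr) Lc) 0 k μ z κ u
      = respStep (d := 3) (Lc ^ 0) (Lc ^ (0 + k + 1)) μ z κ u
        + ((Psi (toSite rr) Lc 0 k (delta1 μ z) - bmGaugeAt (toSite rr) (respStep (d := 3) (Lc ^ 0) (Lc ^ (0 + k + 1)) μ z) Lc) (u + unitVec κ)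
          - (Psi (toSite rr) Lc 0 k (delta1 μ z) - bmGaugeAt (toSite rr) (respStep (d := 3) (Lc ^ 0) (Lc ^ (0 + k + 1)) μ z) Lc) u) := by
  rw [legChain_respStepBmSeq_apply_eq_add_dz hrr 0 k μ z κ u, dz_apply']

/-- NOT IN PRINT; OUR BOOKKEEPING.  **THE MAXWELL OPERATOR OF THE UNDRESSED LEG AT `m = 0` IS THE TRANSLATED TENT FORCE**:
`curvAdj (curv (respStep (Lc^0) (Lc^(0+k+1)) μ z)) = contourSumAdj (Lc^(k+1)) φ_{μ,z}`. -/
theorem curvAdj_curv_respStep_zero_eq_contourSumAdj (k : ℕ) (μ : Fin (3 + 1)) (z : Site (3 + 1)) :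
    curvAdj (curv (respStep (d := 3) (Lc ^ 0) (Lc ^ (0 + k + 1)) μ z))
      = contourSumAdj (Lc ^ (k + 1)) (fun κ y => wΦ (N := Lc ^ (k + 1)) κ μ (y - z)) := by
  haveI : NeZero (Lc ^ (k + 1)) := ⟨pow_ne_zero _ (NeZero.ne Lc)⟩
  rw [respStep_pow_zero]
  exact curvAdj_curv_respStep_one_eq_contourSumAdj (N := Lc ^ (k + 1)) μ z

/-- NOT IN PRINT; OUR BOOKKEEPING.  **THE MAXWELL OPERATOR OF THE DRESSED LEG AT `m = 0` IS THE SAME TENT FORCE** (leaf-03's §10 + an5's `wH_EL'`). -/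
theorem curvAdj_curv_legChain_zero_eq_contourSumAdj (hrr : rr ∈ box (3 + 1) Lc) (k : ℕ) (μ : Fin (3 + 1)) (z : Site (3 + 1)) :
    curvAdj (curv (legChain (respStepBmSeq (d := 3) (toSite rr) Lc) 0 k μ z))
      = contourSumAdj (Lc ^ (k + 1)) (fun κ y => wΦ (N := Lc ^ (k + 1)) κ μ (y - z)) := by
  rw [curvAdj_curv_legChain_eq hrr 0 k μ z, curvAdj_curv_respStep_zero_eq_contourSumAdj]

end Letters

end Summit.QuantumFields.BalabanUV.Beta.GAN24.ContactCellLetters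

end
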